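import Literature.AnabelianGeometry.AbsoluteAnabelian.AbsTopII.DecompositionGroups

/-!
# [AbsTopII] Prop 1.3 (iv): the «Moreover» clauses of situations (2) and (3)

S. Mochizuki, *Topics in Absolute Anabelian Geometry II* [AbsTopII] (bib `MochizukiAbsTopII2013`;
locators = PDF pages of the kurims manuscript `paper:url-585b8d0ad0d9`, 76 pp.), §1 "A Combinatorial
Analogue of Stable Polycurves", Proposition 1.3 (iv), pp. 11–12 (proof pp. 13–15), Def 1.2 (ii)
p. 10.  Printed text of (iv), second half (p. 12 l. 3–9):

> "Moreover, in the situation of (2), we have `I_v ∩ I_{v′} = {1}`, [for appropriate choices of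
> conjugates of the various inertia and decomposition groups involved] `D_v ∩ D_{v′} ∩ Π_I = I_e`;
> in the situation of (3), we have `Π_v ∩ Π_{v′} = I_v ∩ I_{v′} = I_v ∩ I_{v″} = I_{v′} ∩ I_{v″} = {1}`,
> [for appropriate choices of conjugates of the various inertia and decomposition groups involved]
> `D_v ∩ D_{v′} ∩ Π_I = I_{v″}`.  In particular, `I_v ∩ I_{v′} ≠ {1}` implies that `v = v′`."

Statements file (ONE predicate), abc-iut-L4-t6 lineage ([AbsTopII] §1 typer of record), cell
abc-iut row «P13iv-MOREOVER» (abc-iut-L4-lead RULING #5x).  It is ADDITIVE over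
abc-iut-L4-t4's `DPSCData` / `DPSCData.Prop13iv'` (`AbsTopII/DecompositionGroups.lean`, p404475 /
p425881), whose docstring records that these refined clauses were "not typed (as before)": the
trichotomy (1)/(2)/(3) and the "In particular" ARE `Prop13iv'`; the two «Moreover» sentences are
`Prop13iv_moreover` below.  Nothing of t4's file is re-declared.

READING OF RECORD (conjugacy scope, erratum E-L4-9 convention: `Π_𝔾`-conjugates, Def 1.2 (ii) p. 10
"each vertex `v` … determines [up to conjugation in `Π_𝔾`] a subgroup `Π_v ⊆ Π_𝔾`").  The printed
proof (p. 13 last lines – p. 14 l. 6) establishes the bracketed equalities for the CONFIGURED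
conjugates: in situation (2) for the two branch conjugates of the node `e` joining `v, v′`
("`I_e = Π_e · I_v = Π_e · I_{v′} ⊆ D_v ∩ D_{v′} ∩ Π_I ⊆ Z_{Π_I}(I_v × I_{v′}) ⊆ C_{Π_I}(I_e) = I_e`"),
in situation (3) for a path configuration `v – v″ – v′` ("`(Ẑ^Σ ≅) I_{v″} ⊆ D_v ∩ D_{v′} ∩ Π_I ↪ I`
[so `I_{v″} = D_v ∩ D_{v′} ∩ Π_I`]").  They are therefore typed EXISTENTIALLY over the
`Π_𝔾`-conjugates (`∃ γ δ ∈ Π_𝔾, D_v ∩ γD_{v′}γ⁻¹ ∩ Π_I = δI_eδ⁻¹`, resp. `= δI_{v″}δ⁻¹`), and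
deliberately NOT for an arbitrary `γ ∈ Π_𝔾` with `D_v ∩ γD_{v′}γ⁻¹ ∩ Π_I ≠ {1}`: print's cases
(2)/(3) are cut by adjacency IN `𝔾`, and when `v, v′` are adjacent by a node `e` AND joined by a
path `v – v″ – v′` (a triangle), a pro-vertex pair over `(v, v′)` at distance 2 has
`D ∩ D ∩ Π_I = I_{ṽ″}`, which is not a conjugate of `I_e (≅ Ẑ^Σ × Ẑ^Σ)` — so a "for the given
`γ`" rendering of the situation-(2) equality would be stronger than print and false there.  The
unbracketed equalities are typed UNIVERSALLY over `Π_𝔾`-conjugates: "`Π_v ∩ Π_{v′} = {1}`" for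
distinct non-adjacent `v, v′` is the claim of p. 14 l. 20 ("`D_v ∩ D_{v′} ∩ Π_𝔾 = Π_v ∩ Π_{v′} = {1}`",
proved for arbitrary conjugates under "(1) and (2) are false"), and the `I`-intersections vanish for
distinct vertices by the "In particular" clause.

HONEST FRAMING: a PREDICATE on abstract DPSC data, asserted by print for the data of Def 1.2 (ii)
(a stable log curve over a log point); typed ≠ proved; no model-relative comparison is asserted;
nothing here bears on [IUTchIII] Cor 3.12.  Proof-only consequences (the base-graph form
"`Π_v ∩ γΠ_{v′}γ⁻¹ ≠ {1} ⇒ v = v′` or `v, v′` adjacent" used as input (A3) of [IUTchI] Prop 2.1) live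
in the companion `AbsTopII/DecompositionGroupsMoreoverProofs.lean`.
-/

open scoped Pointwise

universe u

namespace Literature.AnabelianGeometry.AbsoluteAnabelian

namespace DPSCData

variable (X : DPSCData.{u})

/-- **[AbsTopII] Prop 1.3 (iv), the «Moreover» clauses** (p. 12 l. 3–9), over the trichotomy
`Prop13iv'`: **(2)** if `v ≠ v′` are adjacent — joined by a node `e` — then "we have
`I_v ∩ I_{v′} = {1}`, [for appropriate choices of conjugates of the various inertia and decomposition
groups involved] `D_v ∩ D_{v′} ∩ Π_I = I_e`": there are `Π_𝔾`-conjugates `γI_{v′}γ⁻¹`, `γD_{v′}γ⁻¹`,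
`δI_eδ⁻¹` (`γ, δ ∈ Π_𝔾`; the branch configuration at `e`) with `I_v ∩ γI_{v′}γ⁻¹ = {1}` and
`D_v ∩ γD_{v′}γ⁻¹ ∩ Π_I = δI_eδ⁻¹`; **(3)** if `v ≠ v′` are non-adjacent and `v″ ≠ v, v′` is adjacent
to `v` and to `v′`, then "we have `Π_v ∩ Π_{v′} = I_v ∩ I_{v′} = I_v ∩ I_{v″} = I_{v′} ∩ I_{v″} = {1}`"
(for all `Π_𝔾`-conjugates) and "[for appropriate choices of conjugates …] `D_v ∩ D_{v′} ∩ Π_I = I_{v″}`"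
(`∃ γ, δ ∈ Π_𝔾`, the path configuration `v – v″ – v′`: `D_v ∩ γD_{v′}γ⁻¹ ∩ Π_I = δI_{v″}δ⁻¹`).
Scope per Def 1.2 (ii) p. 10 ("up to conjugation in `Π_𝔾`"); see the module docstring for why the
bracketed equalities are existential and not "for the given conjugate".
[cite: MochizukiAbsTopII2013, Prop 1.3 (iv) p.12] -/
def Prop13iv_moreover : Prop :=
  (∀ (v v' : X.Vert) (e : X.Node), v ≠ v' → X.nodeAbuts e v → X.nodeAbuts e v' →
      ∃ γ : X.PiH, γ ∈ X.PiG ∧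
        X.Iv v ⊓ MulAut.conj γ • X.Iv v' = ⊥ ∧
        ∃ δ : X.PiH, δ ∈ X.PiG ∧
          X.Dv v ⊓ MulAut.conj γ • X.Dv v' ⊓ X.PiI = MulAut.conj δ • X.IvNode e) ∧
    ∀ (v v' v'' : X.Vert), v ≠ v' → ¬ X.Adjacent v v' → v'' ≠ v → v'' ≠ v' →
      X.Adjacent v v'' → X.Adjacent v'' v' →
      (∀ γ : X.PiH, γ ∈ X.PiG →
          X.vertSub v ⊓ MulAut.conj γ • X.vertSub v' = ⊥ ∧
          X.Iv v ⊓ MulAut.conj γ • X.Iv v' = ⊥ ∧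
          X.Iv v ⊓ MulAut.conj γ • X.Iv v'' = ⊥ ∧
          X.Iv v' ⊓ MulAut.conj γ • X.Iv v'' = ⊥) ∧
      ∃ γ : X.PiH, γ ∈ X.PiG ∧ ∃ δ : X.PiH, δ ∈ X.PiG ∧
        X.Dv v ⊓ MulAut.conj γ • X.Dv v' ⊓ X.PiI = MulAut.conj δ • X.Iv v''

end DPSCData

end Literature.AnabelianGeometry.AbsoluteAnabelian
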